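import Literature.Algebra.Homology.DiscreteRepOpenSubgroupCanonical
import Literature.Algebra.Homology.ExtMapExactFunctorNaturality
import Mathlib.RepresentationTheory.FiniteIndex
import HarnessLib

/-!
# `cores ∘ res = [Γ : U]` on `Extⁿ_{C_Γ}(k, M)`

Topic `Algebra/Homology`; namespace `Literature.Algebra.Homology.DiscreteRep`.  Sequel of
`DiscreteRepOpenSubgroup(Canonical)` and `ExtMapExactFunctorNaturality`; no named fact, no `sorry`.

For an open subgroup `U ≤ Γ` of finite index and the abelian categories `C_Γ`, `C_U` of discrete
`k`-linear representations:
* `Rep.resCoindUnit_coindResCounit_apply` — in Mathlib's `Rep`: the composite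
  `B → Coind_U^Γ Res B → B` of the unit of `Res ⊣ Coind` (`b ↦ (g ↦ g b)`) and the counit of
  `Coind ⊣ Res` (finite index, through `Ind ≅ Coind`: `f ↦ ∑_{U g} g⁻¹ f(g)`) is multiplication by
  the index `[Γ : U]`;
* `unit_counit_apply` — the same in `C_Γ` for `resCoindAdj` / `coindResAdj`;
* `extRes` (`Res : Extⁿ_{C_Γ}(A, B) → Extⁿ_{C_U}(Res A, Res B)`) and `extCores`
  (`cores : Extⁿ_{C_U}(k, Res M) → Extⁿ_{C_Γ}(k, M)`, the Shapiro isomorphism followed by the counit);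
* **`extCores_extRes`** — `cores (res x) = x ∘ [η_M ≫ ε_M]`, where the endomorphism `η_M ≫ ε_M` of `M`
  is multiplication by `[Γ : U]` (`unit_counit_apply`); this is [Harari2020, Theorem 1.48; profinite case §4.3 (3)]
  (`cores ∘ res = [Γ : U]`) on the `Ext` side of the comparison `Extⁿ_{C_Γ}(k, ·) ≅ Hⁿ_cont(Γ, ·)`.

## References
* D. Harari, *Galois Cohomology and Class Field Theory*, Springer (2020), §1.6 Theorem 1.48
  (`Cores ∘ Res = m`), Exercise 1.1 (b) (Cores via Shapiro), §4.3 (3) (open subgroups of a profinite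
  group), §1.5 Definition 1.33 (restriction). [Harari2020]
-/

-- CITATION-FIX (2026-08-27, door-c4 g13; referee V-g52-7 / flag Q-g51-1, held copy
-- `book:harari2017-galois-cohomology-class-field-theory`): earlier revisions cited "Prop. 16.17 (iii)" —
-- Prop. 16.17 (p. 272) is the cup-product/`Ext`-pairing compatibility and has NO enumerated parts; the
-- printed home of `Cores ∘ Res = [G : H]` is Theorem 1.48 (§1.6, p. 52: "the composite Cores ∘ Res is the
-- multiplication by m in H^i(G, A)"), for open subgroups of a profinite group §4.3 (3) (p. 97); Cores via
-- Shapiro is Exercise 1.1 (b) (p. 53); restriction is §1.5 Definition 1.33, corestriction §1.6.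
-- Citations corrected; declarations unchanged.

noncomputable section

universe u

/-! ## §1 The index identity in Mathlib's `Rep` -/

namespace Literature.Algebra.Homology

namespace DiscreteRep

open CategoryTheory CategoryTheory.Limits CategoryTheory.Abelian

section RepLevel

variable {k G : Type u} [CommRing k] [Group G] (S : Subgroup G) [S.FiniteIndex]
  [DecidableRel (QuotientGroup.rightRel S)]

/-- **`ε ∘ η = [G : S]`**: for `B` a `k`-linear `G`-representation and `S ≤ G` of finite index, the unit
`B → Coind_S^G Res B`, `b ↦ (g ↦ g • b)`, of `Res ⊣ Coind` followed by the counit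
`Coind_S^G Res B ≅ Ind_S^G Res B → B`, `f ↦ ∑_{S g} g⁻¹ • f g`, of `Coind ⊣ Res` is multiplication by the
index. [cite: Harari2020, §1.6 Theorem 1.48; §4.3 (3)] -/
theorem Rep.resCoindUnit_coindResCounit_apply (B : Rep.{u} k G) (b : B.V) :
    ((Rep.coindResAdjunction k S).counit.app B).hom
        (((Rep.resCoindAdjunction k S.subtype).unit.app B).hom b) = (S.index : k) • b := by
  letI := Subgroup.fintypeQuotientOfFiniteIndex (H := S)
  rw [Rep.coindResAdjunction_counit_app, Adjunction.mkOfHomEquiv_unit_app]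
  change ((Rep.indResAdjunction k S.subtype).counit.app B).hom
    (((Rep.res S.subtype B).indCoindIso.inv).hom
      ((Rep.resCoindToHom S.subtype B (Rep.res S.subtype B) (𝟙 _)).hom b)) = _
  erw [Adjunction.mkOfHomEquiv_counit_app]
  change ((Rep.indResHomEquiv S.subtype (Rep.res S.subtype B) B).symm (𝟙 _)).hom
    (Rep.coindToInd (Rep.res S.subtype B)
      ((Rep.resCoindToHom S.subtype B (Rep.res S.subtype B) (𝟙 _)).hom b)) = _
  rw [Rep.coindToInd_apply, map_sum,
    Finset.sum_eq_card_nsmul (b := b) (fun x _ => Quotient.inductionOn x fun g => ?_)]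
  · rw [Finset.card_univ, ← Nat.cast_smul_eq_nsmul k, QuotientGroup.card_quotient_rightRel,
      Subgroup.index_eq_card, Nat.card_eq_fintype_card]
  · simp [Rep.indResHomEquiv]

end RepLevel

/-! ## §2 The index identity in `C_Γ` -/

variable {k Γ : Type u} [CommRing k] [Group Γ] [TopologicalSpace Γ] [IsTopologicalGroup Γ]
  (U : Subgroup Γ) (hU : IsOpen (U : Set Γ)) [U.FiniteIndex]

/-- **`ε_M ∘ η_M = [Γ : U]` in `C_Γ`**: for `M ∈ C_Γ`, the unit of `resCoindAdj` followed by the counit of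
`coindResAdj` acts on vectors as multiplication by the index. [cite: Harari2020, §1.6 Theorem 1.48; §4.3 (3)] -/
theorem unit_counit_apply (M : DiscreteRepCat k Γ) (v : M.obj.V) :
    ((coindResAdj U hU).counit.app M).hom.hom (((resCoindAdj U hU).unit.app M).hom.hom v) =
      (U.index : k) • v := by
  letI : DecidableRel (QuotientGroup.rightRel U) := Classical.decRel _
  have h1 : (ι k Γ).map ((resCoindAdj U hU).unit.app M) =
      (Rep.resCoindAdjunction k U.subtype).unit.app M.obj := by
    refine (Adjunction.map_restrictFullyFaithful_unit_app (Rep.resCoindAdjunction k U.subtype)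
      (iC := ι k Γ) (iD := ι k U) (L := resD k U) (R := coindD k U hU)
      (isDiscrete k Γ).fullyFaithfulι (isDiscrete k U).fullyFaithfulι (Iso.refl _) (Iso.refl _)
      M).trans ?_
    erw [CategoryTheory.Functor.map_id, Category.comp_id]
    rfl
  have h2 : (ι k Γ).map ((coindResAdj U hU).counit.app M) =
      (Rep.coindResAdjunction k U).counit.app M.obj := by
    refine (Adjunction.map_restrictFullyFaithful_counit_app (Rep.coindResAdjunction k U)
      (iC := ι k U) (iD := ι k Γ) (L := coindD k U hU) (R := resD k U)
      (isDiscrete k U).fullyFaithfulι (isDiscrete k Γ).fullyFaithfulι (Iso.refl _) (Iso.refl _)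
      M).trans ?_
    erw [CategoryTheory.Functor.map_id, Category.id_comp, Category.id_comp]
    rfl
  change ((ι k Γ).map ((coindResAdj U hU).counit.app M)).hom
    (((ι k Γ).map ((resCoindAdj U hU).unit.app M)).hom v) = _
  rw [h1, h2]
  exact Rep.resCoindUnit_coindResCounit_apply U M.obj v

/-! ## §3 `res`, `cores` on `Ext` and `cores ∘ res` -/

section Ext

/-- **Restriction on `Ext`**: `Res : Extⁿ_{C_Γ}(A, B) → Extⁿ_{C_U}(Res A, Res B)` (Mathlib's
`Functor.mapExtAddHom` of the exact functor `resD`; its exactness instances are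
`preservesFiniteLimits_resD U hU` / `preservesFiniteColimits_resD U hU`, supplied with `haveI`).
[cite: Harari2020, §1.5 Definition 1.33; §1.6 Exercise 1.1 (b)] -/
abbrev extRes [PreservesFiniteLimits (resD k U)] [PreservesFiniteColimits (resD k U)]
    (A B : DiscreteRepCat k Γ) (n : ℕ) :
    Ext A B n →+ Ext ((resD k U).obj A) ((resD k U).obj B) n :=
  (resD k U).mapExtAddHom A B n

/-- **Corestriction on `Ext` with trivial source**: `cores : Extⁿ_{C_U}(k, Res M) → Extⁿ_{C_Γ}(k, M)`, the
canonical Shapiro isomorphism `Extⁿ_{C_U}(Res k, Res M) ≅ Extⁿ_{C_Γ}(k, Coind Res M)` followed by the counit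
`Coind Res M → M` of `Coind ⊣ Res` (the source is written `Res k`, which is `k` definitionally:
`resD_triv`). [cite: Harari2020, §1.5 Definition 1.33; §1.6 Exercise 1.1 (b)] -/
def extCores (M : DiscreteRepCat k Γ) (n : ℕ) :
    Ext ((resD k U).obj (triv (k := k) (Γ := Γ) k)) ((resD k U).obj M) n →+
      Ext (triv (k := k) (Γ := Γ) k) M n :=
  ((Ext.mk₀ ((coindResAdj U hU).counit.app M)).postcomp (triv (k := k) (Γ := Γ) k) (add_zero n)).comp
    (shapiroCanonical U hU (triv (k := k) (Γ := Γ) k) ((resD k U).obj M) n).toAddMonoidHom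

/-- Formula for `extCores`. [cite: Harari2020, §1.5 Definition 1.33; §1.6 Exercise 1.1 (b)] -/
theorem extCores_apply (M : DiscreteRepCat k Γ) (n : ℕ)
    (y : Ext ((resD k U).obj (triv (k := k) (Γ := Γ) k)) ((resD k U).obj M) n) :
    extCores U hU M n y =
      ((Ext.mk₀ (ExtAdjunction.unitHom (resCoindAdj U hU) (triv (k := k) (Γ := Γ) k))).comp
        (y.mapExactFunctor (coindD k U hU)) (zero_add n)).comp
        (Ext.mk₀ ((coindResAdj U hU).counit.app M)) (add_zero n) := rfl

/-- **`cores ∘ res = [Γ : U]`** [Harari2020, Thm. 1.48 / §4.3 (3)] on `Extⁿ_{C_Γ}(k, M)`: `cores (res x)` is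
`x` composed with the endomorphism `η_M ≫ ε_M` of `M`, which is multiplication by the index `[Γ : U]`
(`unit_counit_apply`).  Requires `C_Γ` to have enough injectives (it does: `DiscreteRepCoinduced`).
[cite: Harari2020, §1.6 Theorem 1.48; §4.3 (3)] -/
theorem extCores_extRes [PreservesFiniteLimits (resD k U)] [PreservesFiniteColimits (resD k U)]
    [EnoughInjectives (DiscreteRepCat k Γ)] (M : DiscreteRepCat k Γ) (n : ℕ)
    (x : Ext (triv (k := k) (Γ := Γ) k) M n) :
    extCores U hU M n (extRes U (triv (k := k) (Γ := Γ) k) M n x) =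
      x.comp (Ext.mk₀ ((resCoindAdj U hU).unit.app M ≫ (coindResAdj U hU).counit.app M : M ⟶ M))
        (add_zero n) := by
  haveI := comp_preservesFiniteLimits (resD k U) (coindD k U hU)
  haveI := comp_preservesFiniteColimits (resD k U) (coindD k U hU)
  rw [Functor.mapExtAddHom_apply, extCores_apply,
    ← ExtFunctoriality.mapExactFunctor_comp_functor (resD k U) (coindD k U hU) x]
  have hu : ExtAdjunction.unitHom (resCoindAdj U hU) (triv (k := k) (Γ := Γ) k) =
      (resCoindAdj U hU).unit.app (triv (k := k) (Γ := Γ) k) :=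
    Adjunction.homEquiv_id _ _
  have hτ := ExtFunctoriality.mapExactFunctor_natTrans (F := 𝟭 (DiscreteRepCat k Γ))
    (G := resD k U ⋙ coindD k U hU) (resCoindAdj U hU).unit x
  rw [ExtFunctoriality.mapExactFunctor_id] at hτ
  rw [hu]
  erw [hτ]
  change (x.comp (Ext.mk₀ ((resCoindAdj U hU).unit.app M :
      M ⟶ (coindD k U hU).obj ((resD k U).obj M))) (add_zero n)).comp
    (Ext.mk₀ ((coindResAdj U hU).counit.app M : (coindD k U hU).obj ((resD k U).obj M) ⟶ M))
      (add_zero n) = _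
  rw [Ext.comp_assoc_of_second_deg_zero, Ext.mk₀_comp_mk₀]
  rfl

end Ext

end DiscreteRep

end Literature.Algebra.Homology

/-! ## §4 The index identity as a morphism identity, and `cores ∘ res = [Γ : U] •` -/

namespace Literature.Algebra.Homology

namespace DiscreteRep

open CategoryTheory CategoryTheory.Limits CategoryTheory.Abelian

section NSMul

variable {k Γ : Type u} [CommRing k] [Group Γ] [TopologicalSpace Γ]

/-- `(m • f) v = m • f v` for morphisms of `C_Γ`. [cite: Harari2020, §4.2] -/
theorem nsmul_hom_hom_apply {A B : DiscreteRepCat k Γ} (f : A ⟶ B) (m : ℕ) (v : A.obj.V) :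
    (m • f).hom.hom v = (m : k) • f.hom.hom v := by
  induction m with
  | zero => simp
  | succ m ih =>
    rw [succ_nsmul, Nat.cast_succ, add_smul, one_smul, ← ih]
    rfl

end NSMul

variable {k Γ : Type u} [CommRing k] [Group Γ] [TopologicalSpace Γ] [IsTopologicalGroup Γ]
  (U : Subgroup Γ) (hU : IsOpen (U : Set Γ)) [U.FiniteIndex]

/-- `mk₀ (m • f) = m • mk₀ f`. [cite: Harari2020, §4.2] -/
theorem mk₀_nsmul {A B : DiscreteRepCat k Γ} (f : A ⟶ B) (m : ℕ) :
    Ext.mk₀ (m • f) = m • Ext.mk₀ f := by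
  rw [← Ext.addEquiv₀_symm_apply, map_nsmul, Ext.addEquiv₀_symm_apply]

/-- `x ∘ (m • y) = m • (x ∘ y)`. [cite: Harari2020, §4.2] -/
theorem comp_nsmul {A B C : DiscreteRepCat k Γ} {a b c : ℕ} (x : Ext A B a) (y : Ext B C b)
    (h : a + b = c) (m : ℕ) : x.comp (m • y) h = m • x.comp y h := by
  induction m with
  | zero => rw [zero_nsmul, zero_nsmul, Ext.comp_zero]
  | succ m ih => rw [succ_nsmul, succ_nsmul, Ext.comp_add, ih]


/-- **`η_M ≫ ε_M = [Γ : U] • 𝟙_M`** in `C_Γ` (unit of `Res ⊣ Coind`, counit of `Coind ⊣ Res`).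
[cite: Harari2020, §1.6 Theorem 1.48; §4.3 (3)] -/
theorem unit_comp_counit_eq_nsmul (M : DiscreteRepCat k Γ) :
    ((resCoindAdj U hU).unit.app M ≫ (coindResAdj U hU).counit.app M : M ⟶ M) = U.index • 𝟙 M := by
  refine ObjectProperty.hom_ext _ (Rep.hom_ext (DFunLike.ext _ _ fun v => ?_))
  rw [nsmul_hom_hom_apply]
  exact unit_counit_apply U hU M v

/-- **`cores ∘ res = [Γ : U] •` on `Extⁿ_{C_Γ}(k, M)`** [Harari2020, Thm. 1.48 / §4.3 (3)].
[cite: Harari2020, §1.6 Theorem 1.48; §4.3 (3)] -/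
theorem extCores_extRes_eq_nsmul [PreservesFiniteLimits (resD k U)]
    [PreservesFiniteColimits (resD k U)] [EnoughInjectives (DiscreteRepCat k Γ)]
    (M : DiscreteRepCat k Γ) (n : ℕ) (x : Ext (triv (k := k) (Γ := Γ) k) M n) :
    extCores U hU M n (extRes U (triv (k := k) (Γ := Γ) k) M n x) = U.index • x := by
  rw [extCores_extRes, unit_comp_counit_eq_nsmul, mk₀_nsmul, comp_nsmul, Ext.comp_mk₀_id]

end DiscreteRep

end Literature.Algebra.Homology

/-! ## §5 `cores` commutes with the connecting homomorphisms -/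

namespace Literature.Algebra.Homology

namespace DiscreteRep

open CategoryTheory CategoryTheory.Limits CategoryTheory.Abelian

variable {k Γ : Type u} [CommRing k] [Group Γ] [TopologicalSpace Γ] [IsTopologicalGroup Γ]
  (U : Subgroup Γ) (hU : IsOpen (U : Set Γ)) [U.FiniteIndex]

/-- The class of the restricted short exact sequence maps, under `Coind`, to a class compatible with
the counit: `[Coind Res S] ∘ ε₁ = ε₃ ∘ [S]`. [cite: Harari2020, §1.6 (Cores compatible with the morphisms of short exact sequences, p. 52)] -/
theorem extClass_coindRes_comp_counit [PreservesFiniteLimits (resD k U)]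
    [PreservesFiniteColimits (resD k U)] {S : ShortComplex (DiscreteRepCat k Γ)} (hS : S.ShortExact) :
    haveI := comp_preservesFiniteLimits (resD k U) (coindD k U hU)
    haveI := comp_preservesFiniteColimits (resD k U) (coindD k U hU)
    (ExtFunctoriality.mapSC_shortExact (resD k U ⋙ coindD k U hU) hS).extClass.comp
        (Ext.mk₀ ((coindResAdj U hU).counit.app S.X₁)) (add_zero 1) =
      (Ext.mk₀ ((coindResAdj U hU).counit.app S.X₃)).comp hS.extClass (zero_add 1) := by
  haveI := comp_preservesFiniteLimits (resD k U) (coindD k U hU)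
  haveI := comp_preservesFiniteColimits (resD k U) (coindD k U hU)
  exact ExtFunctoriality.extClass_natTrans (F := resD k U ⋙ coindD k U hU) (G := 𝟭 _)
    (coindResAdj U hU).counit hS

/-- **`cores ∘ δ = δ ∘ cores`**: for a short exact `S` in `C_Γ` and `y ∈ Extⁿ_{C_U}(Res k, Res S.X₃)`,
`cores (y ∘ [Res S]) = cores (y) ∘ [S]` (the classes `[Res S] ∈ Ext¹_{C_U}`, `[S] ∈ Ext¹_{C_Γ}` are the
connecting classes; `[Res S]` is written with `ExtFunctoriality.mapSC`). [cite: Harari2020, §1.6 (Cores compatible with the morphisms of short exact sequences, p. 52)] -/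
theorem extCores_comp_extClass [PreservesFiniteLimits (resD k U)] [PreservesFiniteColimits (resD k U)]
    {S : ShortComplex (DiscreteRepCat k Γ)} (hS : S.ShortExact) (n : ℕ)
    (y : Ext ((resD k U).obj (triv (k := k) (Γ := Γ) k)) ((resD k U).obj S.X₃) n) :
    extCores U hU S.X₁ (n + 1)
        (y.comp (ExtFunctoriality.mapSC_shortExact (resD k U) hS).extClass (rfl : n + 1 = n + 1)) =
      (extCores U hU S.X₃ n y).comp hS.extClass (rfl : n + 1 = n + 1) := by
  haveI := comp_preservesFiniteLimits (resD k U) (coindD k U hU)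
  haveI := comp_preservesFiniteColimits (resD k U) (coindD k U hU)
  rw [extCores_apply, extCores_apply, Ext.mapExactFunctor_comp,
    ExtFunctoriality.mapExactFunctor_extClass' (coindD k U hU)
      (ExtFunctoriality.mapSC_shortExact (resD k U) hS),
    ← ExtFunctoriality.extClass_mapSC_comp (resD k U) (coindD k U hU) hS,
    ← Ext.comp_assoc (Ext.mk₀ (ExtAdjunction.unitHom (resCoindAdj U hU) (triv (k := k) (Γ := Γ) k)))
      (y.mapExactFunctor (coindD k U hU)) _ (zero_add n) rfl (by omega),
    Ext.comp_assoc_of_third_deg_zero]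
  erw [extClass_coindRes_comp_counit U hU hS]
  erw [← Ext.comp_assoc_of_second_deg_zero]
  rfl

end DiscreteRep

end Literature.Algebra.Homology
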